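import Summits.QuantumFields.YangMills.Theorems.UnitScaleTiltFluctuationComparisonRegPrLiftPlaquette
import Literature.MathematicalPhysics.QuantumFieldTheory.Balaban1983to89.LatticeWordStokes

/-!
# Route `UnitScaleTilt` — crux K1bR-pr `FluctuationComparisonRegPr` (stmt-QuantumFields-19201), stub `stub_oneStepSmallLift`
# (W7 line), piece (L2-iii)(b), first layer: TRANSPORTS AND (0.4) LOOP VARIABLES OF A LEFT-MULTIPLIED CONFIGURATION `E · W`
# (support file `--supports stmt-QuantumFields-19201`)

Cell `ym3-torus` (rung R3), seat `ym3-torus-p2` gen 8; CARD-19201-oneStepSmallLift-L1L2.md §2.  For the approximate lift `U⋆ = E · faceSec V`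
(`E = exp ζ`) the middle-bond repair needs every (0.4) loop variable of `U⋆` inside the solvability radius.  Exact twisted-product identity +
triangle bound, in any gauge group:

* `twistedHol E W γ`, `holAt_mulField`: `𝒰_{E·W}(γ) = twistedHol E W γ · 𝒰_W(γ)` along ANY step list `γ`;
* `dist1_twistedHol_le`: `dist1 (twistedHol E W γ) ≤ Σ_{s∈γ} dist1 (E s.bond) ≤ |γ|·ε`;
* `dist1_loopHol_mulField_faceSec_le`: the loop variables of (0.4) of `E · faceSec V` are within `((d+2)L)·ε` of `1` whenever every `E(b)` is
  within `ε` of `1` (`BlockAveragingSection.loopHol_faceSec`: those of `faceSec V` are `1`; `LatticeWordStokes.length_loopWord_le`).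

Elementary; nothing of Bałaban's is asserted.
-/

noncomputable section

namespace Summit.QuantumFields.YangMills.Theorems.ApproxLift

open Literature.MathematicalPhysics.QuantumFieldTheory.Balaban1983to89
open Literature.MathematicalPhysics.QuantumFieldTheory.Balaban1983to89.T4Continuum
open Literature.MathematicalPhysics.QuantumFieldTheory.Balaban1983to89.BlockAveraging
open Literature.MathematicalPhysics.QuantumFieldTheory.Balaban1983to89.BlockAveragingSection

variable {P : Params} {j : ℕ} {G : Type*} [GaugeGroup G]

/-- THE TWISTED PRODUCT of `E` along a step list, relative to the transports of `W`:
forward step `b`: `E(b) · Ad_{W(b)}(rest)`; backward step `b`: `Ad_{W(b)⁻¹}(E(b)⁻¹ · rest)`. -/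
def twistedHol (E W : GaugeField P j G) : List (LStep P j) → G
  | [] => 1
  | s :: γ => if s.fwd then E s.bond * (W s.bond * twistedHol E W γ * (W s.bond)⁻¹)
      else (W s.bond)⁻¹ * ((E s.bond)⁻¹ * twistedHol E W γ) * W s.bond

/-- `twistedHol` of the empty list. -/
@[simp] theorem twistedHol_nil (E W : GaugeField P j G) : twistedHol E W [] = 1 := rfl

/-- `twistedHol` of a cons. -/
theorem twistedHol_cons (E W : GaugeField P j G) (s : LStep P j) (γ : List (LStep P j)) :
    twistedHol E W (s :: γ) = if s.fwd then E s.bond * (W s.bond * twistedHol E W γ * (W s.bond)⁻¹)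
      else (W s.bond)⁻¹ * ((E s.bond)⁻¹ * twistedHol E W γ) * W s.bond := rfl

/-- **TRANSPORT OF A LEFT-MULTIPLIED CONFIGURATION** (exact identity in any group): `𝒰_{E·W}(γ) = twistedHol E W γ · 𝒰_W(γ)`. -/
theorem holAt_mulField (E W : GaugeField P j G) : ∀ γ : List (LStep P j),
    holAt (mulField E W) γ = twistedHol E W γ * holAt W γ
  | [] => by rw [holAt_nil, holAt_nil, twistedHol_nil, one_mul]
  | s :: γ => by
    rw [holAt_cons, holAt_cons, twistedHol_cons, holAt_mulField E W γ, mulField_apply]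
    by_cases h : s.fwd
    · simp only [h, if_true]
      group
    · simp only [h, if_false, Bool.false_eq_true]
      group

/-- The twisted product is within `Σ_{s∈γ} dist1 (E s.bond)` of `1`. -/
theorem dist1_twistedHol_le (E W : GaugeField P j G) : ∀ γ : List (LStep P j),
    dist1 (twistedHol E W γ) ≤ (γ.map fun s => dist1 (E s.bond)).sum
  | [] => by rw [twistedHol_nil, GaugeGroup.dist1_one]; simp
  | s :: γ => by
    rw [twistedHol_cons, List.map_cons, List.sum_cons]
    have ih := dist1_twistedHol_le E W γ
    by_cases h : s.fwd
    · simp only [h, if_true]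
      calc dist1 (E s.bond * (W s.bond * twistedHol E W γ * (W s.bond)⁻¹))
          ≤ dist1 (E s.bond) + dist1 (W s.bond * twistedHol E W γ * (W s.bond)⁻¹) := GaugeGroup.dist1_mul_le _ _
        _ = dist1 (E s.bond) + dist1 (twistedHol E W γ) := by rw [GaugeGroup.dist1_conj]
        _ ≤ _ := by linarith
    · simp only [h, if_false, Bool.false_eq_true]
      have hc : dist1 ((W s.bond)⁻¹ * ((E s.bond)⁻¹ * twistedHol E W γ) * W s.bond) = dist1 ((E s.bond)⁻¹ * twistedHol E W γ) := by
        have := GaugeGroup.dist1_conj ((E s.bond)⁻¹ * twistedHol E W γ) (W s.bond)⁻¹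
        rwa [inv_inv] at this
      rw [hc]
      calc dist1 ((E s.bond)⁻¹ * twistedHol E W γ) ≤ dist1 (E s.bond)⁻¹ + dist1 (twistedHol E W γ) := GaugeGroup.dist1_mul_le _ _
        _ = dist1 (E s.bond) + dist1 (twistedHol E W γ) := by rw [GaugeGroup.dist1_inv]
        _ ≤ _ := by linarith

/-- A list sum of terms each `≤ ε` is `≤ length · ε`. -/
theorem sum_map_le_length_mul {α : Type*} (l : List α) (f : α → ℝ) {ε : ℝ} (h : ∀ a ∈ l, f a ≤ ε) :
    (l.map f).sum ≤ l.length * ε := by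
  induction l with
  | nil => simp
  | cons a l ih =>
    rw [List.map_cons, List.sum_cons, List.length_cons, Nat.cast_succ, add_mul, one_mul]
    have h1 := h a List.mem_cons_self
    have h2 := ih fun b hb => h b (List.mem_cons_of_mem a hb)
    linarith

/-- **THE (0.4) LOOP VARIABLES OF A FACE-SECTION-BASED LIFT ARE SMALL**: if every `E(b)` is within `ε` of `1` (`ε ≥ 0`), every loop
variable `W_i(E · faceSec V)` at every coarse bond is within `((d+2)L)·ε` of `1` — the face section's own loop variables are `1`
(`loopHol_faceSec`) and the loop words have length `≤ (d+2)L`.  This is the guard/solvability condition of the middle-bond repair for the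
approximate lift `U⋆ = exp(ζ)·faceSec V`. -/
theorem dist1_loopHol_mulField_faceSec_le (hj : j + 1 ≤ P.m + P.K) {ε : ℝ} (hε : 0 ≤ ε) {E : GaugeField P j G}
    (hE : ∀ b, dist1 (E b) ≤ ε) (V : GaugeField P (j + 1) G) (c : PBond P (j + 1)) (i : Idx P) :
    dist1 (loopHol (mulField E (faceSec V)) c i) ≤ (((P.d + 2) * P.L : ℕ) : ℝ) * ε := by
  unfold loopHol
  rw [holAt_mulField]
  have h1 : holAt (faceSec V) (walk (emb c.src) (loopWord P.L c.dir (off i.1) i.2.1 i.2.2)) = 1 := loopHol_faceSec hj V c i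
  rw [h1, mul_one]
  refine (dist1_twistedHol_le E (faceSec V) _).trans ?_
  refine (sum_map_le_length_mul _ _ fun s _ => hE s.bond).trans ?_
  have hlen_walk : ∀ (w : List (Letter P.d)) (x : Site P j), (walk x w).length = w.length := by
    intro w
    induction w with
    | nil => intro x; rfl
    | cons l w ih =>
      intro x
      obtain ⟨μ, b⟩ := l
      cases b
      · show ((⟨⟨x.unshift μ, μ⟩, false⟩ : LStep P j) :: walk (x.unshift μ) w).length = _
        rw [List.length_cons, List.length_cons, ih]
      · show ((⟨⟨x, μ⟩, true⟩ : LStep P j) :: walk (x.shift μ) w).length = _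
        rw [List.length_cons, List.length_cons, ih]
  rw [hlen_walk]
  have hlen : ((loopWord P.L c.dir (off i.1) i.2.1 i.2.2).length : ℝ) ≤ (((P.d + 2) * P.L : ℕ) : ℝ) := by
    exact_mod_cast LatticeWordStokes.length_loopWord_le c i
  exact mul_le_mul_of_nonneg_right hlen hε

end Summit.QuantumFields.YangMills.Theorems.ApproxLift

end
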